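import Mathlib
import Literature.Analysis.ODE.VolterraRecessiveInverseSquare
import Summits.FinalStateConjecture.FinalStateConjecture.Theorems.PhotonSphereChannelsUniformPhotonSphereChannelsRPeelSeed
import Summits.FinalStateConjecture.FinalStateConjecture.Theorems.PhotonSphereChannelsUniformPhotonSphereChannelsRPeelStaticTools

/-!
# Peeling, file 9: the finite-energy static mode `u` of the residual potential

Support file for `stub_peel` of the line `crum-peeling-recessive-tower` (crux
`UniformPhotonSphereChannelsR`, stmt-FinalStateConjecture-14074).  The single surviving kernel
direction after `ℓ` Darboux rungs is the recessive (bounded) solution `u` of `u'' = Q u`: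

* `exists_staticMode_rung` (`ℓ ≥ 1`): with the last superpotential `W` (`W' = U − W²`,
  `Q = 2W² − U = W² − W' ≥ 0`, `x W ≤ −3/4` far out) and its seed `w` (`w' = Ww`), the function
  `u = I/w`, `I(x) = ∫_x^∞ w²`, is smooth and positive on `(a, ∞)`, solves `u'' = Q u`
  (reduction of order around `1/w`), grows at most like `x^{1/4}`, hence (file 8) is non-increasing
  with `|u'(x)| ≤ u(xf)/(x − xf)` and finite static energy on `(xf, ∞)`;
* `exists_staticMode_zero` (`ℓ = 0`): for a smooth `V ≥ 0` with `V ≤ K/x³` far out, the recessive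
  solution at `+∞` of `Literature.Analysis.ODE.exists_isSchrodingerSol_recessive_inverseSquare`
  (`ℓ = 0`: `u → 1`) has the same package on `(a, ∞)`.
-/

noncomputable section

-- the doubled `FinalStateConjecture` component is the tree's fixed summit/problem path
set_option linter.dupNamespace false

namespace Summit.FinalStateConjecture.FinalStateConjecture.Theorems.CrumPeelingRecessiveTower

open MeasureTheory Set Filter Topology intervalIntegral
open scoped ContDiff

/-- From `HasDerivAt` data `u' = du`, `du' = Q u` on `(a, ∞)`: `deriv u = du` and
`iteratedDeriv 2 u = Q u` there. -/
theorem iteratedDeriv_two_eq_of_hasDerivAt {u du Q : ℝ → ℝ} {a : ℝ}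
    (hu : ∀ x, a < x → HasDerivAt u (du x) x) (hdu : ∀ x, a < x → HasDerivAt du (Q x * u x) x)
    {x : ℝ} (hx : a < x) : deriv u x = du x ∧ iteratedDeriv 2 u x = Q x * u x := by
  refine ⟨(hu x hx).deriv, ?_⟩
  rw [iteratedDeriv_succ, iteratedDeriv_one]
  have hev : deriv u =ᶠ[𝓝 x] du := by
    filter_upwards [Ioi_mem_nhds hx] with y hy
    exact (hu y hy).deriv
  rw [hev.deriv_eq]
  exact (hdu x hx).deriv

/-- Positivity from a sign at one point: a function with no zero on `(a, ∞)`, continuous there and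
positive at some point of `(a, ∞)`, is positive on `(a, ∞)`. -/
theorem pos_of_ne_zero_of_pos {u : ℝ → ℝ} {a x₁ : ℝ} (huc : ContinuousOn u (Ioi a))
    (hne : ∀ x, a < x → u x ≠ 0) (hx₁ : a < x₁) (hpos : 0 < u x₁) : ∀ x, a < x → 0 < u x := by
  intro x hx
  by_contra hle
  have hux : u x < 0 := lt_of_le_of_ne (not_lt.1 hle) (hne x hx)
  have hpre : IsPreconnected (Ioi a) := isPreconnected_Ioi
  obtain ⟨c, hc, hc0⟩ := hpre.intermediate_value₂ hx hx₁ huc continuousOn_const hux.le hpos.le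
  exact hne c hc hc0

/-- **The static mode after `ℓ ≥ 1` rungs.**  See the module docstring. -/
theorem exists_staticMode_rung {a xf X₁ : ℝ} {W U Q w : ℝ → ℝ} (haxf : a < xf) (haX : a < X₁)
    (hX0 : 0 < X₁) (hW : ContDiffOn ℝ ∞ W (Ioi a))
    (hWd : ∀ x, a < x → HasDerivAt W (U x - W x ^ 2) x)
    (hQ : ∀ x, a < x → Q x = 2 * W x ^ 2 - U x) (hQ0 : ∀ x, a < x → 0 ≤ Q x)
    (hrec : ∀ x, X₁ ≤ x → x * W x ≤ -3 / 4)
    (hw0 : ∀ x, a < x → 0 < w x) (hwd : ∀ x, a < x → HasDerivAt w (W x * w x) x)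
    (hwC : ContDiffOn ℝ ∞ w (Ioi a)) :
    ∃ u : ℝ → ℝ, ContDiffOn ℝ ∞ u (Ioi a) ∧ (∀ x, a < x → iteratedDeriv 2 u x = Q x * u x) ∧
      (∀ x, a < x → 0 < u x) ∧ (∀ x, xf ≤ x → u x ≤ u xf) ∧
      (∀ x, xf < x → |deriv u x| ≤ u xf / (x - xf)) ∧
      IntegrableOn (fun x => deriv u x ^ 2) (Ioi xf) ∧
      IntegrableOn (fun x => Q x * u x ^ 2) (Ioi xf) := by
  have hwc : ContinuousOn w (Ioi a) := hwC.continuousOn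
  have hw2c : ContinuousOn (fun y => w y ^ 2) (Ioi a) := hwc.pow 2
  have hw2i : ∀ X, a < X → IntegrableOn (fun y => w y ^ 2) (Ioi X) := fun X hX =>
    seed_sq_integrableOn haX hX0 hw0 hwd hrec hX
  -- the tail `I = ∫_x^∞ w²`
  set I : ℝ → ℝ := fun x => ∫ y in Ioi x, w y ^ 2 with hI
  have hId : ∀ x, a < x → HasDerivAt I (-(w x ^ 2)) x := by
    intro x hx
    have hX' : a < (a + x) / 2 := by linarith
    exact Literature.Analysis.ODE.hasDerivAt_integral_Ioi
      (hw2c.mono fun y hy => lt_of_lt_of_le hX' hy) (hw2i _ hX') (by linarith)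
  have hIpos : ∀ x, a < x → 0 < I x := by
    intro x hx
    have hsplit : I x = (∫ y in Ioc x (x + 1), w y ^ 2) + I (x + 1) := by
      simp only [hI]
      rw [← Ioc_union_Ioi_eq_Ioi (show x ≤ x + 1 by linarith),
        setIntegral_union (Ioc_disjoint_Ioi le_rfl) measurableSet_Ioi
          ((hw2i x hx).mono_set Ioc_subset_Ioi_self) ((hw2i x hx).mono_set (Ioi_subset_Ioi (by linarith)))]
    have h1 : 0 < ∫ y in Ioc x (x + 1), w y ^ 2 := by
      rw [← intervalIntegral.integral_of_le (by linarith : x ≤ x + 1)]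
      refine intervalIntegral.intervalIntegral_pos_of_pos_on ?_ (fun y hy => pow_pos (hw0 y (hx.trans hy.1)) 2)
        (by linarith)
      exact (hw2c.mono fun y hy => hx.trans_le hy.1).intervalIntegrable_of_Icc (by linarith)
    have h2 : 0 ≤ I (x + 1) := setIntegral_nonneg measurableSet_Ioi fun y _ => sq_nonneg _
    rw [hsplit]; linarith
  have hIC : ContDiffOn ℝ ∞ I (Ioi a) :=
    contDiffOn_infty_of_deriv_eq (F := fun x _ => -(w x ^ 2)) isOpen_Ioi
      (fun x hx => (hId x hx).differentiableAt.differentiableWithinAt)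
      ((hwC.comp contDiffOn_fst fun p hp => (mem_prod.1 hp).1).pow 2).neg
      fun x hx => (hId x hx).deriv
  -- `u = I / w`, `du = −w − W u`
  set u : ℝ → ℝ := fun x => I x / w x with hu_def
  set du : ℝ → ℝ := fun x => -w x - W x * u x with hdu_def
  have huC : ContDiffOn ℝ ∞ u (Ioi a) := hIC.div hwC fun x hx => (hw0 x hx).ne'
  have hupos : ∀ x, a < x → 0 < u x := fun x hx => div_pos (hIpos x hx) (hw0 x hx)
  have hu : ∀ x, a < x → HasDerivAt u (du x) x := by
    intro x hx
    have hwx := (hw0 x hx).ne'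
    have h : HasDerivAt (fun y => I y / w y)
        ((-(w x ^ 2) * w x - I x * (W x * w x)) / w x ^ 2) x := (hId x hx).div (hwd x hx) hwx
    have he : (-(w x ^ 2) * w x - I x * (W x * w x)) / w x ^ 2 = du x := by
      simp only [hdu_def, hu_def]; field_simp
    rw [he] at h
    exact h
  have hdu : ∀ x, a < x → HasDerivAt du (Q x * u x) x := by
    intro x hx
    have h : HasDerivAt (fun y => -w y - W y * u y)
        (-(W x * w x) - ((U x - W x ^ 2) * u x + W x * du x)) x :=
      (hwd x hx).neg.sub ((hWd x hx).mul (hu x hx))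
    have he : -(W x * w x) - ((U x - W x ^ 2) * u x + W x * du x) = Q x * u x := by
      rw [hQ x hx]; simp only [hdu_def]; ring
    rw [he] at h
    exact h
  -- growth `u(x)² ≤ K x^{1/2}` beyond `X₁`
  set Cw : ℝ := w X₁ * X₁ ^ ((3 : ℝ) / 4) with hCw
  have hgrowth : ∀ x, X₁ ≤ x → u x ^ 2 ≤ (4 * Cw ^ 2) * x ^ ((1 : ℝ) / 2) := by
    intro x hx
    have hxa : a < x := haX.trans_le hx
    have hx0 : 0 < x := hX0.trans_le hx
    have hwx := hw0 x hxa
    -- `I(x) ≤ 2 x w(x)²`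
    have hIle : I x ≤ 2 * x * w x ^ 2 := by
      have hcmp : ∀ y ∈ Ioi x, w y ^ 2 ≤ (w x ^ 2 * x ^ ((3 : ℝ) / 2)) * y ^ (-(3 : ℝ) / 2) := by
        intro y hy
        have hy0 : 0 < y := hx0.trans hy
        have hr := seed_ratio_le haX hX0 hw0 hwd hrec hx (le_of_lt hy)
        have hwy := hw0 y (hxa.trans hy)
        have e1 : (y / x) ^ (-(3 : ℝ) / 4) = x ^ ((3 : ℝ) / 4) * y ^ (-(3 : ℝ) / 4) := by
          rw [show (-(3 : ℝ) / 4) = -((3 : ℝ) / 4) by ring, Real.div_rpow hy0.le hx0.le,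
            Real.rpow_neg hx0.le, div_inv_eq_mul, mul_comm]
        have e34 : (x ^ ((3 : ℝ) / 4)) ^ 2 = x ^ ((3 : ℝ) / 2) := by
          rw [← Real.rpow_natCast, ← Real.rpow_mul hx0.le]; norm_num
        have e : (w x * (y / x) ^ (-(3 : ℝ) / 4)) ^ 2 = (w x ^ 2 * x ^ ((3 : ℝ) / 2)) * y ^ (-(3 : ℝ) / 2) := by
          rw [e1, mul_pow, mul_pow, e34, rpow_neg_three_quarters_sq hy0]
          ring
        calc w y ^ 2 ≤ (w x * (y / x) ^ (-(3 : ℝ) / 4)) ^ 2 := pow_le_pow_left₀ hwy.le hr 2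
          _ = _ := e
      have hdom : IntegrableOn (fun y : ℝ => (w x ^ 2 * x ^ ((3 : ℝ) / 2)) * y ^ (-(3 : ℝ) / 2)) (Ioi x) :=
        (integrableOn_Ioi_rpow_of_lt (by norm_num : (-(3 : ℝ) / 2) < -1) hx0).const_mul _
      have hmono := setIntegral_mono_on (hw2i x hxa) hdom measurableSet_Ioi hcmp
      rw [MeasureTheory.integral_const_mul, integral_Ioi_rpow_of_lt (by norm_num : (-(3 : ℝ) / 2) < -1) hx0]
        at hmono
      have e2 : (w x ^ 2 * x ^ ((3 : ℝ) / 2)) * (-x ^ (-(3 : ℝ) / 2 + 1) / (-(3 : ℝ) / 2 + 1))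
          = 2 * x * w x ^ 2 := by
        rw [show (-(3 : ℝ) / 2 + 1) = -((1 : ℝ) / 2) by norm_num, Real.rpow_neg hx0.le]
        have h32 : x ^ ((3 : ℝ) / 2) = x * x ^ ((1 : ℝ) / 2) := by
          rw [show ((3 : ℝ) / 2) = 1 + (1 : ℝ) / 2 by norm_num, Real.rpow_add hx0, Real.rpow_one]
        have hs0 : x ^ ((1 : ℝ) / 2) ≠ 0 := (Real.rpow_pos_of_pos hx0 _).ne'
        rw [h32]
        field_simp
      rw [e2] at hmono
      exact hmono
    have hule : u x ≤ 2 * x * w x := by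
      simp only [hu_def]
      rw [div_le_iff₀ hwx]
      calc I x ≤ 2 * x * w x ^ 2 := hIle
        _ = 2 * x * w x * w x := by ring
    have hwle : w x ≤ Cw * x ^ (-(3 : ℝ) / 4) := seed_le_mul_rpow haX hX0 hw0 hwd hrec hx
    have hCw0 : 0 ≤ Cw := by
      simp only [hCw]; exact mul_nonneg (hw0 X₁ haX).le (Real.rpow_nonneg hX0.le _)
    have h2 : u x ≤ 2 * Cw * x ^ ((1 : ℝ) / 4) := by
      have e : x * x ^ (-(3 : ℝ) / 4) = x ^ ((1 : ℝ) / 4) := by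
        rw [show (-(3 : ℝ) / 4) = ((1 : ℝ) / 4) - 1 by norm_num, Real.rpow_sub_one hx0.ne']
        field_simp
      calc u x ≤ 2 * x * w x := hule
        _ ≤ 2 * x * (Cw * x ^ (-(3 : ℝ) / 4)) := mul_le_mul_of_nonneg_left hwle (by positivity)
        _ = 2 * Cw * (x * x ^ (-(3 : ℝ) / 4)) := by ring
        _ = 2 * Cw * x ^ ((1 : ℝ) / 4) := by rw [e]
    have e4 : (x ^ ((1 : ℝ) / 4)) ^ 2 = x ^ ((1 : ℝ) / 2) := by
      rw [← Real.rpow_natCast, ← Real.rpow_mul hx0.le]; norm_num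
    calc u x ^ 2 ≤ (2 * Cw * x ^ ((1 : ℝ) / 4)) ^ 2 := pow_le_pow_left₀ (hupos x hxa).le h2 2
      _ = (4 * Cw ^ 2) * x ^ ((1 : ℝ) / 2) := by rw [mul_pow, e4]; ring
  -- no growing branch, hence `du ≤ 0`
  have hF := mul_deriv_nonpos_of_growth hu hdu hQ0 hgrowth
  have hneg : ∀ x, a < x → du x ≤ 0 := by
    intro x hx
    rcases mul_nonpos_iff.1 (hF x hx) with h | h
    · exact h.2
    · exact absurd h.1 (not_le.2 (hupos x hx))
  -- continuity of `Q`
  have hQc : ContinuousOn Q (Ioi a) := by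
    have hUc : ContinuousOn U (Ioi a) := by
      have hdW : ContinuousOn (deriv W) (Ioi a) :=
        hW.continuousOn_deriv_of_isOpen isOpen_Ioi (WithTop.coe_le_coe.2 le_top)
      refine (hdW.add (hW.continuousOn.pow 2)).congr fun x hx => ?_
      show U x = deriv W x + W x ^ 2
      rw [(hWd x hx).deriv]; ring
    have h2 : ContinuousOn (fun x => 2 * W x ^ 2 - U x) (Ioi a) :=
      (continuousOn_const.mul (hW.continuousOn.pow 2)).sub hUc
    exact h2.congr fun x hx => hQ x hx
  obtain ⟨hle, hderiv, -, hI1, hI2⟩ := static_package haxf hu hdu hQc hQ0 hupos hneg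
  refine ⟨u, huC, fun x hx => (iteratedDeriv_two_eq_of_hasDerivAt hu hdu hx).2, hupos, hle,
    fun x hx => ?_, ?_, hI2⟩
  · rw [(hu x (haxf.trans hx)).deriv]; exact hderiv x hx
  · exact hI1.congr_fun (fun x hx => by rw [(hu x (haxf.trans hx)).deriv]) measurableSet_Ioi

/-- **The static mode for `ℓ = 0`.**  See the module docstring. -/
theorem exists_staticMode_zero {V : ℝ → ℝ} {a xf X₀ K : ℝ} (haxf : a < xf) (hX₀ : 1 ≤ X₀)
    (hV : ContDiff ℝ ∞ V) (hV0 : ∀ x, 0 ≤ V x) (hVB : ∀ x, X₀ ≤ x → V x ≤ K / x ^ 3) :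
    ∃ u : ℝ → ℝ, ContDiffOn ℝ ∞ u (Ioi a) ∧ (∀ x, a < x → iteratedDeriv 2 u x = V x * u x) ∧
      (∀ x, a < x → 0 < u x) ∧ (∀ x, xf ≤ x → u x ≤ u xf) ∧
      (∀ x, xf < x → |deriv u x| ≤ u xf / (x - xf)) ∧
      IntegrableOn (fun x => deriv u x ^ 2) (Ioi xf) ∧
      IntegrableOn (fun x => V x * u x ^ 2) (Ioi xf) := by
  have hVc : Continuous V := hV.continuous
  have hX₀0 : 0 < X₀ := by linarith
  have hK : 0 ≤ K := by
    have h := hVB X₀ le_rfl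
    have h0 := hV0 X₀
    have : 0 ≤ K / X₀ ^ 3 := h0.trans h
    exact (div_nonneg_iff.1 this).elim (fun h => h.1) fun h => by
      have : (0 : ℝ) < X₀ ^ 3 := by positivity
      linarith [h.2]
  set x₀ : ℝ := max X₀ (8 * K + 1) with hx₀
  have hx₀1 : 1 ≤ x₀ := le_trans hX₀ (le_max_left _ _)
  have hx₀0 : 0 < x₀ := by linarith
  -- the Volterra smallness `∫_{x₀}^∞ y |V| ≤ K/x₀ ≤ 1/8`
  have hbound : ∀ y, x₀ ≤ y → y * |V y| ≤ K * y ^ (-(2 : ℝ)) := by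
    intro y hy
    have hy0 : 0 < y := hx₀0.trans_le hy
    have hVy := hVB y (le_trans (le_max_left _ _) hy)
    rw [abs_of_nonneg (hV0 y), Real.rpow_neg hy0.le, show ((2 : ℝ)) = ((2 : ℕ) : ℝ) by norm_num,
      Real.rpow_natCast]
    calc y * V y ≤ y * (K / y ^ 3) := mul_le_mul_of_nonneg_left hVy hy0.le
      _ = K * (y ^ 2)⁻¹ := by field_simp
  have hWi : IntegrableOn (fun y => y * |V y|) (Ioi x₀) := by
    have hdom : IntegrableOn (fun y : ℝ => K * y ^ (-(2 : ℝ))) (Ioi x₀) :=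
      (integrableOn_Ioi_rpow_of_lt (by norm_num : (-(2 : ℝ)) < -1) hx₀0).const_mul K
    refine hdom.mono' ((continuous_id.mul hVc.abs).aestronglyMeasurable) ?_
    filter_upwards [ae_restrict_mem measurableSet_Ioi] with y hy
    rw [Real.norm_eq_abs, abs_of_nonneg (mul_nonneg (hx₀0.trans hy).le (abs_nonneg _))]
    exact hbound y (le_of_lt hy)
  have hQ : ∫ y in Ioi x₀, y * |V y| ≤ 1 / 8 := by
    have hdom : IntegrableOn (fun y : ℝ => K * y ^ (-(2 : ℝ))) (Ioi x₀) :=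
      (integrableOn_Ioi_rpow_of_lt (by norm_num : (-(2 : ℝ)) < -1) hx₀0).const_mul K
    have h1 : ∫ y in Ioi x₀, y * |V y| ≤ ∫ y in Ioi x₀, K * y ^ (-(2 : ℝ)) :=
      setIntegral_mono_on hWi hdom measurableSet_Ioi fun y hy => hbound y (le_of_lt hy)
    rw [MeasureTheory.integral_const_mul, integral_Ioi_rpow_of_lt (by norm_num : (-(2 : ℝ)) < -1) hx₀0] at h1
    have e : K * (-x₀ ^ (-(2 : ℝ) + 1) / (-(2 : ℝ) + 1)) = K / x₀ := by
      rw [show (-(2 : ℝ) + 1) = -1 by norm_num, Real.rpow_neg_one]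
      field_simp
    rw [e] at h1
    have h2 : K / x₀ ≤ 1 / 8 := by
      rw [div_le_div_iff₀ hx₀0 (by norm_num : (0 : ℝ) < 8)]
      have : 8 * K + 1 ≤ x₀ := le_max_right _ _
      nlinarith
    exact h1.trans h2
  obtain ⟨U, hU, hU1, -⟩ :=
    Literature.Analysis.ODE.exists_isSchrodingerSol_recessive_inverseSquare hVc hVc hx₀1 0
      (fun x _ => by simp) hWi hQ
  -- `|U − 1| ≤ 3/8` beyond `x₀`
  have hclose : ∀ x, x₀ < x → |U x - 1| ≤ 3 / 8 := by
    intro x hx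
    have h := hU1 x hx
    simp only [pow_zero, one_mul] at h
    have hnn : 0 ≤ᵐ[volume.restrict (Ioi x₀)] fun y => y * |V y| := by
      filter_upwards [ae_restrict_mem measurableSet_Ioi] with y hy
      exact mul_nonneg (hx₀0.trans hy).le (abs_nonneg _)
    have htail : ∫ y in Ioi x, y * |V y| ≤ ∫ y in Ioi x₀, y * |V y| :=
      setIntegral_mono_set hWi hnn (ae_of_all _ (Ioi_subset_Ioi hx.le))
    linarith
  have hUpos_far : ∀ x, x₀ < x → 5 / 8 ≤ U x := fun x hx => by
    have := hclose x hx; rw [abs_le] at this; linarith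
  have hUle_far : ∀ x, x₀ < x → U x ≤ 11 / 8 := fun x hx => by
    have := hclose x hx; rw [abs_le] at this; linarith
  -- derivatives
  have hu : ∀ x, a < x → HasDerivAt U (deriv U x) x := fun x _ => hU.hasDerivAt x
  have hdu : ∀ x, a < x → HasDerivAt (deriv U) (V x * U x) x := fun x _ => hU.hasDerivAt_deriv x
  -- growth and the sign of `U U'`
  have hgrowth : ∀ x, x₀ + 1 ≤ x → U x ^ 2 ≤ 2 * x ^ ((1 : ℝ) / 2) := by
    intro x hx
    have hx' : x₀ < x := by linarith
    have hx1 : 1 ≤ x := by linarith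
    have h1 : U x ^ 2 ≤ (11 / 8) ^ 2 :=
      pow_le_pow_left₀ (by linarith [hUpos_far x hx']) (hUle_far x hx') 2
    have h2 : (1 : ℝ) ≤ x ^ ((1 : ℝ) / 2) := Real.one_le_rpow hx1 (by norm_num)
    nlinarith
  have hF := mul_deriv_nonpos_of_growth hu hdu (fun x _ => hV0 x) hgrowth
  -- `U²` is non-increasing on `(a, ∞)`, so `U` has no zero there
  have hsq_anti : AntitoneOn (fun x => U x ^ 2) (Ioi a) := by
    have hd : ∀ x, HasDerivAt (fun x => U x ^ 2) (↑2 * U x ^ (2 - 1) * deriv U x) x := fun x =>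
      (hU.hasDerivAt x).pow 2
    refine antitoneOn_of_deriv_nonpos (convex_Ioi a) (fun x _ => (hd x).continuousAt.continuousWithinAt)
      (fun x _ => (hd x).differentiableAt.differentiableWithinAt) fun x hx => ?_
    rw [interior_Ioi] at hx
    rw [(hd x).deriv]
    have h := hF x hx
    simp only [Nat.add_one_sub_one, pow_one]
    nlinarith
  have hne : ∀ x, a < x → U x ≠ 0 := by
    intro x hx h0
    set y : ℝ := max x (x₀ + 1) with hy
    have hxy : x ≤ y := le_max_left _ _
    have hy₀ : x₀ < y := by have := le_max_right x (x₀ + 1); linarith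
    have hmono := hsq_anti (show a < x from hx) (show a < y from hx.trans_le hxy) hxy
    simp only [h0] at hmono
    have : (5 / 8 : ℝ) ^ 2 ≤ U y ^ 2 := pow_le_pow_left₀ (by norm_num) (hUpos_far y hy₀) 2
    nlinarith
  set x₁ : ℝ := max a x₀ + 1 with hx₁
  have hx₁a : a < x₁ := by have := le_max_left a x₀; linarith
  have hx₁0 : x₀ < x₁ := by have := le_max_right a x₀; linarith
  have hupos : ∀ x, a < x → 0 < U x :=
    pos_of_ne_zero_of_pos (hU.continuous.continuousOn) hne hx₁a (by linarith [hUpos_far x₁ hx₁0])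
  have hneg : ∀ x, a < x → deriv U x ≤ 0 := by
    intro x hx
    rcases mul_nonpos_iff.1 (hF x hx) with h | h
    · exact h.2
    · exact absurd h.1 (not_le.2 (hupos x hx))
  obtain ⟨hle, hderiv, -, hI1, hI2⟩ := static_package haxf hu hdu hVc.continuousOn (fun x _ => hV0 x)
    hupos hneg
  have hsmooth : ContDiffOn ℝ ∞ U (Ioi a) :=
    contDiffOn_infty_of_deriv_deriv_eq isOpen_Ioi hU.differentiable.differentiableOn
      hU.differentiable_deriv.differentiableOn hV.contDiffOn fun x _ => hU.deriv_deriv x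
  exact ⟨U, hsmooth, fun x hx => (iteratedDeriv_two_eq_of_hasDerivAt hu hdu hx).2, hupos, hle, hderiv,
    hI1, hI2⟩

/-- Registered sub-goal `peel_posOfNeZero` of `stub_peel` (verbatim signature): a zero-free continuous function on `(a, ∞)` positive at one point is positive. -/
theorem peel_posOfNeZero : ∀ (u : ℝ → ℝ) (a x₁ : ℝ), ContinuousOn u (Set.Ioi a) → (∀ x, a < x → u x ≠ 0) → a < x₁ → 0 < u x₁ → ∀ x : ℝ, a < x → 0 < u x :=
  fun _ _ _ huc hne hx₁ hpos => pos_of_ne_zero_of_pos huc hne hx₁ hpos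

end Summit.FinalStateConjecture.FinalStateConjecture.Theorems.CrumPeelingRecessiveTower
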